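import Mathlib
import HarnessLib

/-!
# Superadditivity of sumset cardinalities in `ℤ`: `2|A + B + C| ≥ |A + B| + |A + C| + |B + C| − 1`
# (Gyarmati–Matolcsi–Ruzsa 2010, Theorem 1.1 — every number of summands, with the intermediate set `S′`;
# Theorem 1.3 for torsion-free abelian groups)

Topic `Literature/Combinatorics/Additive`.  Cell `mm-stpp` (D-0046), seat `mm-stpp-lit` (gen 7) — the
nearest PRINTED relative of the cell's "room laws" in `ℤ` (eng-1's `STPPRoomLawInt.three_mul_card_add_le`,
KILL-MEMO §6 T23; LIT-INDEX §8 N21), vendored and PROVED so that the family it belongs to has a kernel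
anchor.

**Theorem (Gyarmati–Matolcsi–Ruzsa, Combinatorica 30 (2010), Theorem 1.1).**  "Let `A_1, …, A_k` be
finite, nonempty sets of integers … `S = A_1 + ⋯ + A_k`, `S_i = A_1 + ⋯ + A_{i−1} + A_{i+1} + ⋯ + A_k`.
We have `|S| ≥ |S′| ≥ (1/(k−1)) Σ_{i=1}^k |S_i| − 1/(k−1)`."  Here: the case `k = 3`,
`2|A + B + C| + 1 ≥ |A + B| + |A + C| + |B + C|` (`gmr_superadditivity_three`; the question the paper
answers, attributed there to Ruzsa, with Lev's remark for equal diameters), and its diagonal case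
`2|3A| + 1 ≥ 3|2A|`, i.e. `|3A| ≥ (3/2)|2A| − 1/2` (`lev_card_three_mul`; Lev 1996 as quoted in GMR §1:
"`(|kA| − 1)/k` is increasing").

PROOF = the printed marking argument (GMR §2, "Proof of Theorem 1.1") for `k = 3`, with the minima
not normalised to `0` (thresholds are shifted by the minima instead): in a first copy of
`S = A + B + C` mark `A + B + min C` and, above `max A + max B + min C`, the translate by `max B` of
the part of `A + C` exceeding `max A + min C`; in a second copy mark the translate by `min B` of the
rest of `A + C` and, above `max A + min B + min C`, the translate by `max A` of `B + C` minus its least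
element.  The marked sets are disjoint inside each copy, so `2|S| ≥ |A+B| + |A+C| + (|B+C| − 1)`.
The general case (`n ≥ 2` summands, ℕ-indexed families `A : ℕ → Finset ℤ` on `range n`) is
`gmr_superadditivity`: `Σ_{i<n} |Σ_{j≠i} A_j| ≤ (n − 1)|Σ_j A_j| + 1`, proved by the same marking argument
organised as `n − 1` one-copy inequalities `|S| ≥ |(S_i)_{≤ t_i}| + |(S_{i−1})_{> t_{i−1}}|`
(`t_i = Σ_{j<i} max A_j` after normalising the minima to `0`; `GMR.superadditivity_of_zero_mem`) that
telescope; with Lev's monotonicity `(k+1)|kA| ≤ k|(k+1)A| + 1` (`lev_card_nsmul_mono`).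
THE INTERMEDIATE SET `S′` AND THEOREM 1.3 (appended, gen 8): `GMR.superadditivity_biUnion` (core: any
family `E_i ∋ min A_i, max A_i` in a linearly ordered abelian group gives
`Σ_i |S_i| ≤ (n − 1)|⋃_i (S_i + E_i)| + 1`), `gmr_superadditivity_biUnion` (the printed form with
`E_i = A_i′ = {min A_i, max A_i}` and `S′ ⊆ S`, any linearly ordered abelian group, in particular `ℤ`),
`gmr_superadditivity_of_isAddTorsionFree` (Theorem 1.3: torsion-free abelian groups, `|A_i′| ≤ 2`; via
freeness of the finitely generated subgroup and the lexicographic order on `ℤ^d` instead of the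
printed compression `φ_m : ℤ^d → ℤ`), `GMR.biUnion_add_subset_sum` (`S′ ⊆ S`).
WHAT THIS FILE IS NOT: not Theorem 1.2 (submultiplicativity — see `SumsetSubmultiplicativity.lean`,
every `k`) nor Theorem 1.4 / §4 (restricted sums via Plünnecke-type inequalities for different
summands, not in the tree); nothing modulo `n` (GMR p. 164: the analogue fails in `ℤ/pℤ` beyond small
sets).

## References
* K. Gyarmati, M. Matolcsi, I. Z. Ruzsa, *A superadditivity and submultiplicativity property for
  cardinalities of sumsets*, Combinatorica 30 (2010) 163–174, doi:10.1007/s00493-010-2413-6 =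
  arXiv:0707.2707 — held `paper:arxiv-0707.2707`, chunks p0003 (Theorem 1.1) and p0005 (its proof)
  read 2026-08-27 [cite: GyarmatiMatolcsiRuzsa2010, Thm 1.1]; Theorem 1.3 and §2 "Proof of Theorem 1.3"
  (p0003, p0005) re-read 2026-08-27 (gen 8) [cite: GyarmatiMatolcsiRuzsa2010, Thm 1.3].
* V. F. Lev, *Structure theorem for multiple addition and the Frobenius problem*, J. Number Theory 58
  (1996) 79–88 (the diagonal case; not held, quoted from GMR §1).
-/

namespace Literature.Combinatorics.Additive

open Finset
open scoped Pointwise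

/-- **Gyarmati–Matolcsi–Ruzsa 2010, Theorem 1.1 (`k = 3`).**  For finite non-empty `A, B, C ⊂ ℤ`:
`|A + B| + |A + C| + |B + C| ≤ 2|A + B + C| + 1`. [cite: GyarmatiMatolcsiRuzsa2010, Thm 1.1] -/
theorem gmr_superadditivity_three {A B C : Finset ℤ} (hA : A.Nonempty) (hB : B.Nonempty)
    (hC : C.Nonempty) : #(A + B) + #(A + C) + #(B + C) ≤ 2 * #(A + B + C) + 1 := by
  classical
  set a₁ := A.max' hA with ha₁
  set b₀ := B.min' hB with hb₀
  set b₁ := B.max' hB with hb₁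
  set c₀ := C.min' hC with hc₀
  set S := A + B + C with hS
  -- bounds for elements of the pairwise sumsets
  have hABle : ∀ x ∈ A + B, x ≤ a₁ + b₁ := by
    intro x hx; rw [mem_add] at hx; obtain ⟨a, ha, b, hb, rfl⟩ := hx
    exact add_le_add (le_max' A a ha) (le_max' B b hb)
  have hBCge : ∀ x ∈ B + C, b₀ + c₀ ≤ x := by
    intro x hx; rw [mem_add] at hx; obtain ⟨b, hb, c, hc, rfl⟩ := hx
    exact add_le_add (min'_le B b hb) (min'_le C c hc)
  have hbc : b₀ + c₀ ∈ B + C := add_mem_add (min'_mem B hB) (min'_mem C hC)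
  /- first copy: `A + B + c₀` and `b₁ + (A + C)_{> a₁ + c₀}` -/
  set P₁ : Finset ℤ := (A + B).image (· + c₀) with hP₁
  set Q₁ : Finset ℤ := ((A + C).filter (fun x => a₁ + c₀ < x)).image (· + b₁) with hQ₁
  have hP₁S : P₁ ⊆ S := by
    intro x hx; rw [hP₁, mem_image] at hx; obtain ⟨u, hu, rfl⟩ := hx
    rw [hS]; exact add_mem_add hu (min'_mem C hC)
  have hQ₁S : Q₁ ⊆ S := by
    intro x hx; rw [hQ₁, mem_image] at hx; obtain ⟨u, hu, rfl⟩ := hx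
    rw [mem_filter, mem_add] at hu
    obtain ⟨⟨a, ha, c, hc, rfl⟩, -⟩ := hu
    rw [hS, show a + c + b₁ = a + b₁ + c by ring]
    exact add_mem_add (add_mem_add ha (max'_mem B hB)) hc
  have hdisj₁ : Disjoint P₁ Q₁ := by
    rw [disjoint_left]; intro x hxP hxQ
    rw [hP₁, mem_image] at hxP; obtain ⟨u, hu, rfl⟩ := hxP
    rw [hQ₁, mem_image] at hxQ; obtain ⟨v, hv, he⟩ := hxQ
    rw [mem_filter] at hv
    linarith [hABle u hu, hv.2]
  have hcopy₁ : #(A + B) + #((A + C).filter (fun x => a₁ + c₀ < x)) ≤ #S := by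
    have h := card_le_card (union_subset hP₁S hQ₁S)
    rw [card_union_of_disjoint hdisj₁, hP₁, hQ₁, card_image_of_injective _ (add_left_injective _),
      card_image_of_injective _ (add_left_injective _)] at h
    exact h
  /- second copy: `(A + C)_{≤ a₁ + c₀} + b₀` and `a₁ + (B + C) ∖ {b₀ + c₀}` -/
  set P₂ : Finset ℤ := ((A + C).filter (fun x => ¬ a₁ + c₀ < x)).image (· + b₀) with hP₂
  set Q₂ : Finset ℤ := ((B + C).erase (b₀ + c₀)).image (· + a₁) with hQ₂
  have hP₂S : P₂ ⊆ S := by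
    intro x hx; rw [hP₂, mem_image] at hx; obtain ⟨u, hu, rfl⟩ := hx
    rw [mem_filter, mem_add] at hu
    obtain ⟨⟨a, ha, c, hc, rfl⟩, -⟩ := hu
    rw [hS, show a + c + b₀ = a + b₀ + c by ring]
    exact add_mem_add (add_mem_add ha (min'_mem B hB)) hc
  have hQ₂S : Q₂ ⊆ S := by
    intro x hx; rw [hQ₂, mem_image] at hx; obtain ⟨u, hu, rfl⟩ := hx
    rw [mem_erase, mem_add] at hu
    obtain ⟨-, b, hb, c, hc, rfl⟩ := hu
    rw [hS, show b + c + a₁ = a₁ + b + c by ring]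
    exact add_mem_add (add_mem_add (max'_mem A hA) hb) hc
  have hdisj₂ : Disjoint P₂ Q₂ := by
    rw [disjoint_left]; intro x hxP hxQ
    rw [hP₂, mem_image] at hxP; obtain ⟨u, hu, rfl⟩ := hxP
    rw [hQ₂, mem_image] at hxQ; obtain ⟨v, hv, he⟩ := hxQ
    rw [mem_filter, not_lt] at hu
    rw [mem_erase] at hv
    have hv' : b₀ + c₀ < v := lt_of_le_of_ne (hBCge v hv.2) (Ne.symm hv.1)
    linarith [hu.2]
  have hcopy₂ : #((A + C).filter (fun x => ¬ a₁ + c₀ < x)) + (#(B + C) - 1) ≤ #S := by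
    have h := card_le_card (union_subset hP₂S hQ₂S)
    rw [card_union_of_disjoint hdisj₂, hP₂, hQ₂, card_image_of_injective _ (add_left_injective _),
      card_image_of_injective _ (add_left_injective _), card_erase_of_mem hbc] at h
    exact h
  -- add up
  have hsplit := card_filter_add_card_filter_not (s := A + C) (fun x => a₁ + c₀ < x)
  have hBC1 : 1 ≤ #(B + C) := card_pos.2 ⟨_, hbc⟩
  omega

/-- **Lev 1996** (as quoted in GMR 2010, §1): for a finite non-empty `A ⊂ ℤ`,
`3|2A| ≤ 2|3A| + 1`, i.e. `|3A| ≥ (3/2)|2A| − 1/2`. [cite: GyarmatiMatolcsiRuzsa2010, §1 eq. (1.2)] -/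
theorem lev_card_three_mul {A : Finset ℤ} (hA : A.Nonempty) :
    3 * #(A + A) ≤ 2 * #(A + A + A) + 1 := by
  have := gmr_superadditivity_three hA hA hA
  omega

/-! ## The general case: `k` summands -/

namespace GMR

/-- Translating each summand translates a sumset of finsets: for `m : ℕ → ℤ`,
`∑_{j ∈ T} (A j − m j) = (∑_{j ∈ T} A j) − ∑_{j ∈ T} m j`. [folklore] -/
private theorem sum_image_sub (A : ℕ → Finset ℤ) (m : ℕ → ℤ) (T : Finset ℕ) :
    ∑ j ∈ T, (A j).image (· - m j) = (∑ j ∈ T, A j).image (· - ∑ j ∈ T, m j) := by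
  classical
  induction T using Finset.induction_on with
  | empty => rw [sum_empty, sum_empty, sum_empty]; ext x; simp
  | insert a T ha ih =>
    rw [sum_insert ha, sum_insert ha, sum_insert ha, ih]
    ext x
    simp only [mem_add, mem_image]
    constructor
    · rintro ⟨_, ⟨u, hu, rfl⟩, _, ⟨v, hv, rfl⟩, rfl⟩
      exact ⟨u + v, ⟨u, hu, v, hv, rfl⟩, by ring⟩
    · rintro ⟨_, ⟨u, hu, v, hv, rfl⟩, rfl⟩
      exact ⟨u - m a, ⟨u, hu, rfl⟩, v - ∑ j ∈ T, m j, ⟨v, hv, rfl⟩, by ring⟩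

/-- Hence the size of a sumset of finsets is invariant under translating the summands. [folklore] -/
private theorem card_sum_image_sub (A : ℕ → Finset ℤ) (m : ℕ → ℤ) (T : Finset ℕ) :
    #(∑ j ∈ T, (A j).image (· - m j)) = #(∑ j ∈ T, A j) := by
  rw [sum_image_sub, card_image_of_injective _ (sub_left_injective)]

/-- Elements of a sum of finsets of non-negative integers are non-negative and bounded by the sum of
the maxima. [folklore] -/
private theorem sum_bounds {A : ℕ → Finset ℤ} {M : ℕ → ℤ} (T : Finset ℕ)
    (hnn : ∀ j ∈ T, ∀ x ∈ A j, 0 ≤ x) (hM : ∀ j ∈ T, ∀ x ∈ A j, x ≤ M j) :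
    ∀ x ∈ ∑ j ∈ T, A j, 0 ≤ x ∧ x ≤ ∑ j ∈ T, M j := by
  classical
  induction T using Finset.induction_on with
  | empty => intro x hx; simp only [sum_empty, Finset.mem_zero] at hx; simp [hx]
  | insert a T ha ih =>
    intro x hx
    rw [sum_insert ha, mem_add] at hx
    obtain ⟨u, hu, v, hv, rfl⟩ := hx
    have h1 := hnn a (mem_insert_self a T) u hu
    have h2 := hM a (mem_insert_self a T) u hu
    have h3 := ih (fun j hj => hnn j (mem_insert_of_mem hj)) (fun j hj => hM j (mem_insert_of_mem hj)) v hv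
    rw [sum_insert ha]
    constructor <;> linarith [h3.1, h3.2]

/-- `0` lies in a sum of finsets each containing `0`. [folklore] -/
private theorem zero_mem_sum {A : ℕ → Finset ℤ} (T : Finset ℕ) (h0 : ∀ j ∈ T, (0 : ℤ) ∈ A j) :
    (0 : ℤ) ∈ ∑ j ∈ T, A j := by
  classical
  induction T using Finset.induction_on with
  | empty => simp
  | insert a T ha ih =>
    rw [sum_insert ha]
    have := add_mem_add (h0 a (mem_insert_self a T)) (ih fun j hj => h0 j (mem_insert_of_mem hj))
    rwa [add_zero] at this

/-- The normalised core of GMR Theorem 1.1: all summands contain `0` and are non-negative.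
[cite: GyarmatiMatolcsiRuzsa2010, Thm 1.1 (proof, §2)] -/
theorem superadditivity_of_zero_mem {n : ℕ} (A : ℕ → Finset ℤ) (h0 : ∀ j < n, (0 : ℤ) ∈ A j)
    (hnn : ∀ j < n, ∀ x ∈ A j, 0 ≤ x) (hn : 2 ≤ n) :
    ∑ i ∈ range n, #(∑ j ∈ (range n).erase i, A j) ≤ (n - 1) * #(∑ j ∈ range n, A j) + 1 := by
  classical
  have hne : ∀ j < n, (A j).Nonempty := fun j hj => ⟨0, h0 j hj⟩
  -- maxima and thresholds
  set M : ℕ → ℤ := fun j => if hj : j < n then (A j).max' (hne j hj) else 0 with hM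
  have hMmem : ∀ j < n, M j ∈ A j := by
    intro j hj; simp only [hM, dif_pos hj]; exact max'_mem _ _
  have hMle : ∀ j < n, ∀ x ∈ A j, x ≤ M j := by
    intro j hj x hx; simp only [hM, dif_pos hj]; exact le_max' _ x hx
  set t : ℕ → ℤ := fun i => ∑ j ∈ range i, M j with ht
  set S := ∑ j ∈ range n, A j with hS
  set Sx : ℕ → Finset ℤ := fun i => ∑ j ∈ (range n).erase i, A j with hSx
  set f : ℕ → ℕ := fun i => #((Sx i).filter (· ≤ t i)) with hf
  set g : ℕ → ℕ := fun i => #((Sx i).filter (fun x => t i < x)) with hg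
  have hfg : ∀ i, f i + g i = #(Sx i) := by
    intro i
    simp only [hf, hg]
    have := card_filter_add_card_filter_not (s := Sx i) (fun x => x ≤ t i)
    simp only [not_le] at this
    exact this
  -- ONE COPY: for `1 ≤ i ≤ n − 1`, the marked sets `(S_i)_{≤ t_i}` and `M_{i−1} + (S_{i−1})_{> t_{i−1}}`
  have hcopy : ∀ i, 1 ≤ i → i ≤ n - 1 → f i + g (i - 1) ≤ #S := by
    intro i hi1 hin
    have hin' : i < n := by omega
    have hi1n : i - 1 < n := by omega
    set P : Finset ℤ := (Sx i).filter (· ≤ t i) with hP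
    set Q : Finset ℤ := ((Sx (i - 1)).filter (fun x => t (i - 1) < x)).image (· + M (i - 1)) with hQ
    have hPS : P ⊆ S := by
      intro x hx
      rw [hP, mem_filter] at hx
      have : x + 0 ∈ Sx i + A i := add_mem_add hx.1 (h0 i hin')
      rw [add_zero, hSx] at this
      simp only at this
      rwa [sum_erase_add _ _ (mem_range.2 hin')] at this
    have hQS : Q ⊆ S := by
      intro x hx
      rw [hQ, mem_image] at hx
      obtain ⟨y, hy, rfl⟩ := hx
      rw [mem_filter] at hy
      have : y + M (i - 1) ∈ Sx (i - 1) + A (i - 1) := add_mem_add hy.1 (hMmem _ hi1n)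
      rw [hSx] at this
      simp only at this
      rwa [sum_erase_add _ _ (mem_range.2 hi1n)] at this
    have hti : t i = t (i - 1) + M (i - 1) := by
      simp only [ht]
      conv_lhs => rw [show i = (i - 1) + 1 by omega]
      rw [sum_range_succ]
    have hdisj : Disjoint P Q := by
      rw [disjoint_left]; intro x hxP hxQ
      rw [hP, mem_filter] at hxP
      rw [hQ, mem_image] at hxQ
      obtain ⟨y, hy, rfl⟩ := hxQ
      rw [mem_filter] at hy
      linarith [hxP.2, hy.2]
    have := card_le_card (union_subset hPS hQS)
    rw [card_union_of_disjoint hdisj, hQ, card_image_of_injective _ (add_left_injective _)] at this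
    exact this
  -- boundary terms: `f 0 = 1` and `g (n − 1) = 0`
  have hf0 : f 0 = 1 := by
    simp only [hf, ht, sum_range_zero]
    rw [card_eq_one]
    refine ⟨0, ?_⟩
    ext x
    simp only [mem_filter, mem_singleton]
    constructor
    · rintro ⟨hx, hx0⟩
      have := (sum_bounds ((range n).erase 0) (fun j hj => hnn j (mem_range.1 (mem_of_mem_erase hj)))
        (fun j hj => hMle j (mem_range.1 (mem_of_mem_erase hj))) x hx).1
      omega
    · rintro rfl
      exact ⟨zero_mem_sum _ fun j hj => h0 j (mem_range.1 (mem_of_mem_erase hj)), le_rfl⟩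
  have hgn : g (n - 1) = 0 := by
    simp only [hg, card_eq_zero, filter_eq_empty_iff, not_lt]
    intro x hx
    have hb := (sum_bounds ((range n).erase (n - 1))
      (fun j hj => hnn j (mem_range.1 (mem_of_mem_erase hj)))
      (fun j hj => hMle j (mem_range.1 (mem_of_mem_erase hj))) x hx).2
    have hr : range n = insert (n - 1) (range (n - 1)) := by
      conv_lhs => rw [show n = (n - 1) + 1 by omega]
      exact range_add_one
    have : (range n).erase (n - 1) = range (n - 1) := by
      rw [hr, erase_insert (by simp)]
    rw [this] at hb
    exact hb
  -- telescoping: `Σ_{i<n} #S_i − 1 = Σ_{1 ≤ i ≤ n−1} (f i + g (i−1)) ≤ (n − 1)|S|`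
  have hsum : ∑ i ∈ range (n - 1), (f (i + 1) + g i) ≤ (n - 1) * #S := by
    have : ∑ i ∈ range (n - 1), (f (i + 1) + g i) ≤ ∑ _i ∈ range (n - 1), #S :=
      sum_le_sum fun i hi => by
        rw [mem_range] at hi
        have := hcopy (i + 1) (by omega) (by omega)
        simpa using this
    rwa [sum_const, card_range, smul_eq_mul] at this
  have htel : ∑ i ∈ range (n - 1), (f (i + 1) + g i) + 1 = ∑ i ∈ range n, #(Sx i) := by
    rw [sum_add_distrib]
    have e1 : ∑ i ∈ range (n - 1), f (i + 1) + f 0 = ∑ i ∈ range n, f i := by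
      conv_rhs => rw [show n = (n - 1) + 1 by omega, sum_range_succ']
    have e2 : ∑ i ∈ range (n - 1), g i + g (n - 1) = ∑ i ∈ range n, g i := by
      conv_rhs => rw [show n = (n - 1) + 1 by omega, sum_range_succ]
    have e3 : ∑ i ∈ range n, #(Sx i) = ∑ i ∈ range n, f i + ∑ i ∈ range n, g i := by
      rw [← sum_add_distrib]; exact sum_congr rfl fun i _ => (hfg i).symm
    rw [hf0] at e1; rw [hgn] at e2
    omega
  have := htel ▸ Nat.add_le_add_right hsum 1
  simpa [hSx, hS] using this

end GMR

open GMR in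
/-- **Gyarmati–Matolcsi–Ruzsa 2010, Theorem 1.1 (general number of summands).**  For `n ≥ 2` finite
non-empty sets `A_0, …, A_{n−1} ⊂ ℤ`, with `S = Σ_j A_j` and `S_i = Σ_{j ≠ i} A_j`:
`Σ_i |S_i| ≤ (n − 1)|S| + 1`.  (The printed statement's intermediate set `S′`: see
`gmr_superadditivity_biUnion` below, which refines this through `S′ ⊆ S`.)
[cite: GyarmatiMatolcsiRuzsa2010, Thm 1.1] -/
theorem gmr_superadditivity {n : ℕ} (A : ℕ → Finset ℤ) (hA : ∀ j < n, (A j).Nonempty)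
    (hn : 2 ≤ n) :
    ∑ i ∈ range n, #(∑ j ∈ (range n).erase i, A j) ≤ (n - 1) * #(∑ j ∈ range n, A j) + 1 := by
  classical
  -- translate every summand to have minimum `0`
  set m : ℕ → ℤ := fun j => if hj : j < n then (A j).min' (hA j hj) else 0 with hm
  set A₀ : ℕ → Finset ℤ := fun j => (A j).image (· - m j) with hA₀
  have h0 : ∀ j < n, (0 : ℤ) ∈ A₀ j := by
    intro j hj
    simp only [hA₀, hm, dif_pos hj, mem_image]
    exact ⟨(A j).min' (hA j hj), min'_mem _ _, sub_self _⟩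
  have hnn : ∀ j < n, ∀ x ∈ A₀ j, 0 ≤ x := by
    intro j hj x hx
    simp only [hA₀, hm, dif_pos hj, mem_image] at hx
    obtain ⟨a, ha, rfl⟩ := hx
    linarith [min'_le (A j) a ha]
  have h := superadditivity_of_zero_mem A₀ h0 hnn hn
  have e1 : ∀ i, #(∑ j ∈ (range n).erase i, A₀ j) = #(∑ j ∈ (range n).erase i, A j) :=
    fun i => card_sum_image_sub A m _
  have e2 : #(∑ j ∈ range n, A₀ j) = #(∑ j ∈ range n, A j) := card_sum_image_sub A m _
  simp only [e1, e2] at h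
  exact h

open GMR in
/-- **Lev 1996** (as quoted in GMR 2010, §1: "`(|kA| − 1)/k` is increasing"): for a finite non-empty
`A ⊂ ℤ` and `k ≥ 1`, `(k + 1)·|kA| ≤ k·|(k + 1)A| + 1`. [cite: GyarmatiMatolcsiRuzsa2010, §1] -/
theorem lev_card_nsmul_mono {A : Finset ℤ} (hA : A.Nonempty) {k : ℕ} (hk : 1 ≤ k) :
    (k + 1) * #(k • A) ≤ k * #((k + 1) • A) + 1 := by
  classical
  have h := gmr_superadditivity (n := k + 1) (fun _ => A) (fun _ _ => hA) (by omega)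
  have e1 : ∀ i ∈ range (k + 1), #(∑ _j ∈ (range (k + 1)).erase i, A) = #(k • A) := fun i hi => by
    rw [sum_const, card_erase_of_mem hi, card_range, Nat.add_sub_cancel]
  have e2 : ∑ _j ∈ range (k + 1), A = (k + 1) • A := by rw [sum_const, card_range]
  rw [sum_congr rfl e1, sum_const, card_range, smul_eq_mul, e2, Nat.add_sub_cancel] at h
  exact h

/-! ## Theorem 1.1 through the intermediate set `S′`, and Theorem 1.3 (torsion-free groups)

Appended 2026-08-27 (cell `mm-stpp`, seat `mm-stpp-lit`, gen 8): the refinement of Theorem 1.1 through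
the printed set `S′ = ⋃_i (A_1 + ⋯ + A_i′ + ⋯ + A_k)`, `A_i′ = {min A_i, max A_i}`, stated and proved
in any linearly ordered abelian group (so in `ℤ` verbatim), and Theorem 1.3 for torsion-free abelian
groups.  Source: `paper:arxiv-0707.2707`, Theorem 1.1 / Theorem 1.3 (p. 3 of the arXiv text) and §2
"Proof of superadditivity" (p. 5), re-read at the page 2026-08-27. -/

namespace GMR

section Transfer

variable {H K : Type*} [AddCommMonoid H] [AddCommMonoid K] [DecidableEq H] [DecidableEq K]

/-- The image of a sum of finsets under an additive map is the sum of the images. [folklore] -/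
private theorem image_finsetSum (φ : H →+ K) (B : ℕ → Finset H) (T : Finset ℕ) :
    (∑ j ∈ T, B j).image φ = ∑ j ∈ T, (B j).image φ := by
  induction T using Finset.induction_on with
  | empty => simp only [sum_empty, Finset.image_zero, map_zero]; rfl
  | insert a T haT ih => rw [sum_insert haT, sum_insert haT, image_add, ih]

/-- The image of `⋃_i (S_i + E_i)` under an additive map. [folklore] -/
private theorem image_biUnion_add (φ : H →+ K) (B E : ℕ → Finset H) (n : ℕ) :
    ((range n).biUnion fun i => (∑ j ∈ (range n).erase i, B j) + E i).image φ =
      (range n).biUnion fun i => (∑ j ∈ (range n).erase i, (B j).image φ) + (E i).image φ := by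
  rw [biUnion_image]
  refine biUnion_congr rfl fun i _ => ?_
  rw [image_add, image_finsetSum]

/-- An injective additive map preserves the size of a sum of finsets. [folklore] -/
private theorem card_sum_image (φ : H →+ K) (hφ : Function.Injective φ) (B : ℕ → Finset H)
    (T : Finset ℕ) : #(∑ j ∈ T, (B j).image φ) = #(∑ j ∈ T, B j) := by
  rw [← image_finsetSum, card_image_of_injective _ hφ]

/-- An injective additive map preserves the size of `⋃_i (S_i + E_i)`. [folklore] -/
private theorem card_biUnion_image (φ : H →+ K) (hφ : Function.Injective φ) (B E : ℕ → Finset H)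
    (n : ℕ) :
    #((range n).biUnion fun i => (∑ j ∈ (range n).erase i, (B j).image φ) + (E i).image φ) =
      #((range n).biUnion fun i => (∑ j ∈ (range n).erase i, B j) + E i) := by
  rw [← image_biUnion_add, card_image_of_injective _ hφ]

/-- A sum of chosen elements lies in the sum of the finsets. [folklore] -/
private theorem sum_mem_finsetSum {A : ℕ → Finset H} {m : ℕ → H} (T : Finset ℕ)
    (hm : ∀ j ∈ T, m j ∈ A j) : ∑ j ∈ T, m j ∈ ∑ j ∈ T, A j := by
  induction T using Finset.induction_on with
  | empty => simp
  | insert a T haT ih =>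
    rw [sum_insert haT, sum_insert haT]
    exact Finset.add_mem_add (hm a (mem_insert_self _ _))
      (ih fun j hj => hm j (mem_insert_of_mem hj))

/-- `S′ ⊆ S`, the first printed inequality `|S| ≥ |S′|` of GMR Theorem 1.1 / 1.3, in the form used
here: `⋃_i (S_i + E_i) ⊆ S = Σ_j A_j` as soon as `E_i ⊆ A_i` for `i < n` (any additive commutative
monoid). [cite: GyarmatiMatolcsiRuzsa2010, Thm 1.1] -/
theorem biUnion_add_subset_sum {n : ℕ} (A E : ℕ → Finset H) (hE : ∀ j < n, E j ⊆ A j) :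
    ((range n).biUnion fun i => (∑ j ∈ (range n).erase i, A j) + E i) ⊆ ∑ j ∈ range n, A j := by
  intro x hx
  rw [mem_biUnion] at hx
  obtain ⟨i, hi, hx⟩ := hx
  have h := add_subset_add_left (s := ∑ j ∈ (range n).erase i, A j) (hE i (mem_range.1 hi))
  rw [sum_erase_add _ _ hi] at h
  exact h hx

end Transfer

section Ordered

variable {G : Type*} [AddCommGroup G] [LinearOrder G] [IsOrderedAddMonoid G]

/-- Elements of a sum of finsets lie between the sum of the lower bounds and the sum of the upper
bounds of the summands. [folklore] -/
private theorem sum_bounds_le {A : ℕ → Finset G} {m M : ℕ → G} (T : Finset ℕ)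
    (hm : ∀ j ∈ T, ∀ x ∈ A j, m j ≤ x) (hM : ∀ j ∈ T, ∀ x ∈ A j, x ≤ M j) :
    ∀ x ∈ ∑ j ∈ T, A j, ∑ j ∈ T, m j ≤ x ∧ x ≤ ∑ j ∈ T, M j := by
  classical
  induction T using Finset.induction_on with
  | empty =>
    intro x hx
    rw [sum_empty, Finset.mem_zero] at hx
    subst hx
    simp
  | insert a T haT ih =>
    intro x hx
    rw [sum_insert haT, Finset.mem_add] at hx
    obtain ⟨y, hy, z, hz, rfl⟩ := hx
    have h1 := ih (fun j hj => hm j (mem_insert_of_mem hj))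
      (fun j hj => hM j (mem_insert_of_mem hj)) z hz
    rw [sum_insert haT, sum_insert haT]
    exact ⟨add_le_add (hm a (mem_insert_self _ _) y hy) h1.1,
      add_le_add (hM a (mem_insert_self _ _) y hy) h1.2⟩

/-- **GMR Theorem 1.1 through the intermediate set, in a linearly ordered abelian group** (core form):
if `E_j` contains the least and the greatest element of `A_j` for every `j < n`, then with
`S_i = Σ_{j ≠ i} A_j` one has `Σ_{i<n} |S_i| ≤ (n − 1)·|⋃_{i<n} (S_i + E_i)| + 1`.  The printed
`S′ = ⋃_i S_i′`, `S_i′ = A_1 + ⋯ + A_i′ + ⋯ + A_k`, is the case `E_i = A_i′ = {min A_i, max A_i}`.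
Proof = the printed marking argument (GMR §2) without normalising the minima: with
`t_i = Σ_{j<i} max A_j + Σ_{i<j<n} min A_j`, the sets `min A_i + (S_i)_{≤ t_i}` and
`max A_{i−1} + (S_{i−1})_{> t_{i−1}}` are disjoint subsets of `S′` (`1 ≤ i ≤ n − 1`), and the
`n − 1` resulting inequalities telescope. [cite: GyarmatiMatolcsiRuzsa2010, Thm 1.1 (proof, §2)] -/
theorem superadditivity_biUnion {n : ℕ} (A E : ℕ → Finset G) (hA : ∀ j < n, (A j).Nonempty)
    (hmin : ∀ j (hj : j < n), (A j).min' (hA j hj) ∈ E j)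
    (hmax : ∀ j (hj : j < n), (A j).max' (hA j hj) ∈ E j) (hn : 2 ≤ n) :
    ∑ i ∈ range n, #(∑ j ∈ (range n).erase i, A j) ≤
      (n - 1) * #((range n).biUnion fun i => (∑ j ∈ (range n).erase i, A j) + E i) + 1 := by
  classical
  -- minima, maxima (as total functions) and their properties
  set m : ℕ → G := fun j => if hj : j < n then (A j).min' (hA j hj) else 0 with hm
  set M : ℕ → G := fun j => if hj : j < n then (A j).max' (hA j hj) else 0 with hM
  have hmle : ∀ j < n, ∀ x ∈ A j, m j ≤ x := fun j hj x hx => by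
    simp only [hm, dif_pos hj]; exact min'_le _ x hx
  have hMge : ∀ j < n, ∀ x ∈ A j, x ≤ M j := fun j hj x hx => by
    simp only [hM, dif_pos hj]; exact le_max' _ x hx
  have hmA : ∀ j < n, m j ∈ A j := fun j hj => by
    simp only [hm, dif_pos hj]; exact min'_mem _ _
  have hmE : ∀ j < n, m j ∈ E j := fun j hj => by
    simp only [hm, dif_pos hj]; exact hmin j hj
  have hME : ∀ j < n, M j ∈ E j := fun j hj => by
    simp only [hM, dif_pos hj]; exact hmax j hj
  -- thresholds, the set `S′`, the partial sums `S_i` and the two counting functions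
  set t : ℕ → G := fun i => ∑ j ∈ range i, M j + ∑ j ∈ Ico (i + 1) n, m j with ht
  set S' : Finset G := (range n).biUnion fun i => (∑ j ∈ (range n).erase i, A j) + E i with hS'
  set Sx : ℕ → Finset G := fun i => ∑ j ∈ (range n).erase i, A j with hSx
  set f : ℕ → ℕ := fun i => #((Sx i).filter (· ≤ t i)) with hf
  set g : ℕ → ℕ := fun i => #((Sx i).filter (fun x => t i < x)) with hg
  have hfg : ∀ i, f i + g i = #(Sx i) := by
    intro i
    simp only [hf, hg]
    have := card_filter_add_card_filter_not (s := Sx i) (fun x => x ≤ t i)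
    simp only [not_le] at this
    exact this
  have hSx_bounds : ∀ i x, x ∈ Sx i →
      ∑ j ∈ (range n).erase i, m j ≤ x ∧ x ≤ ∑ j ∈ (range n).erase i, M j := fun i x hx =>
    sum_bounds_le ((range n).erase i) (fun j hj => hmle j (mem_range.1 (mem_of_mem_erase hj)))
      (fun j hj => hMge j (mem_range.1 (mem_of_mem_erase hj))) x hx
  -- ONE COPY: for `1 ≤ i ≤ n − 1`, the marked sets `min A_i + (S_i)_{≤ t_i}` and
  -- `max A_{i−1} + (S_{i−1})_{> t_{i−1}}` are disjoint subsets of `S′`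
  have hcopy : ∀ i, 1 ≤ i → i ≤ n - 1 → f i + g (i - 1) ≤ #S' := by
    intro i hi1 hin
    have hin' : i < n := by omega
    have hi1n : i - 1 < n := by omega
    set P : Finset G := ((Sx i).filter (· ≤ t i)).image (· + m i) with hP
    set Q : Finset G := ((Sx (i - 1)).filter (fun x => t (i - 1) < x)).image (· + M (i - 1))
      with hQ
    have hPS : P ⊆ S' := by
      intro x hx
      rw [hP, mem_image] at hx
      obtain ⟨y, hy, rfl⟩ := hx
      rw [mem_filter] at hy
      rw [hS', mem_biUnion]
      exact ⟨i, mem_range.2 hin', add_mem_add hy.1 (hmE i hin')⟩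
    have hQS : Q ⊆ S' := by
      intro x hx
      rw [hQ, mem_image] at hx
      obtain ⟨y, hy, rfl⟩ := hx
      rw [mem_filter] at hy
      rw [hS', mem_biUnion]
      exact ⟨i - 1, mem_range.2 hi1n, add_mem_add hy.1 (hME (i - 1) hi1n)⟩
    have hti : t i + m i = t (i - 1) + M (i - 1) := by
      have e1 : ∑ j ∈ range i, M j = ∑ j ∈ range (i - 1), M j + M (i - 1) := by
        conv_lhs => rw [show i = (i - 1) + 1 by omega]
        rw [sum_range_succ]
      have e2 : ∑ j ∈ Ico (i - 1 + 1) n, m j = m i + ∑ j ∈ Ico (i + 1) n, m j := by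
        rw [show i - 1 + 1 = i by omega, sum_eq_sum_Ico_succ_bot hin']
      simp only [ht]
      rw [e1, e2]
      abel
    have hdisj : Disjoint P Q := by
      rw [disjoint_left]
      intro x hxP hxQ
      rw [hP, mem_image] at hxP
      obtain ⟨y, hy, rfl⟩ := hxP
      rw [hQ, mem_image] at hxQ
      obtain ⟨z, hz, hyz⟩ := hxQ
      rw [mem_filter] at hy hz
      have h1 : y + m i ≤ t i + m i := add_le_add hy.2 le_rfl
      have h2 : t (i - 1) + M (i - 1) < z + M (i - 1) := add_lt_add_of_lt_of_le hz.2 le_rfl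
      rw [← hti, hyz] at h2
      exact absurd (lt_of_le_of_lt h1 h2) (lt_irrefl _)
    have := card_le_card (union_subset hPS hQS)
    rw [card_union_of_disjoint hdisj, hP, hQ, card_image_of_injective _ (add_left_injective _),
      card_image_of_injective _ (add_left_injective _)] at this
    exact this
  -- boundary terms: `f 0 = 1` and `g (n − 1) = 0`
  have herase0 : (range n).erase 0 = Ico 1 n := by
    ext j; simp only [mem_erase, mem_range, mem_Ico]; omega
  have heraseLast : (range n).erase (n - 1) = range (n - 1) := by
    ext j; simp only [mem_erase, mem_range]; omega
  have hf0 : f 0 = 1 := by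
    simp only [hf]
    have ht0 : t 0 = ∑ j ∈ (range n).erase 0, m j := by
      simp only [ht, sum_range_zero, zero_add, herase0]
    rw [card_eq_one]
    refine ⟨∑ j ∈ (range n).erase 0, m j, ?_⟩
    ext x
    simp only [mem_filter, mem_singleton]
    constructor
    · rintro ⟨hx, hxt⟩
      rw [ht0] at hxt
      exact le_antisymm hxt (hSx_bounds 0 x hx).1
    · rintro rfl
      refine ⟨?_, by rw [ht0]⟩
      exact sum_mem_finsetSum _ fun j hj => hmA j (mem_range.1 (mem_of_mem_erase hj))
  have hgn : g (n - 1) = 0 := by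
    simp only [hg, card_eq_zero, filter_eq_empty_iff, not_lt]
    intro x hx
    have htn : t (n - 1) = ∑ j ∈ (range n).erase (n - 1), M j := by
      simp only [ht, heraseLast]
      rw [show n - 1 + 1 = n by omega, Ico_self, sum_empty, add_zero]
    rw [htn]
    exact (hSx_bounds (n - 1) x hx).2
  -- telescoping: `Σ_{i<n} #S_i − 1 = Σ_{1 ≤ i ≤ n−1} (f i + g (i−1)) ≤ (n − 1)|S′|`
  have hsum : ∑ i ∈ range (n - 1), (f (i + 1) + g i) ≤ (n - 1) * #S' := by
    have : ∑ i ∈ range (n - 1), (f (i + 1) + g i) ≤ ∑ _i ∈ range (n - 1), #S' :=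
      sum_le_sum fun i hi => by
        rw [mem_range] at hi
        have := hcopy (i + 1) (by omega) (by omega)
        simpa using this
    rwa [sum_const, card_range, smul_eq_mul] at this
  have htel : ∑ i ∈ range (n - 1), (f (i + 1) + g i) + 1 = ∑ i ∈ range n, #(Sx i) := by
    rw [sum_add_distrib]
    have e1 : ∑ i ∈ range (n - 1), f (i + 1) + f 0 = ∑ i ∈ range n, f i := by
      conv_rhs => rw [show n = (n - 1) + 1 by omega, sum_range_succ']
    have e2 : ∑ i ∈ range (n - 1), g i + g (n - 1) = ∑ i ∈ range n, g i := by
      conv_rhs => rw [show n = (n - 1) + 1 by omega, sum_range_succ]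
    have e3 : ∑ i ∈ range n, #(Sx i) = ∑ i ∈ range n, f i + ∑ i ∈ range n, g i := by
      rw [← sum_add_distrib]; exact sum_congr rfl fun i _ => (hfg i).symm
    rw [hf0] at e1; rw [hgn] at e2
    omega
  have := htel ▸ Nat.add_le_add_right hsum 1
  simpa [hSx, hS'] using this

end Ordered

end GMR

section OrderedForms

variable {G : Type*} [AddCommGroup G] [LinearOrder G] [IsOrderedAddMonoid G]

/-- **Gyarmati–Matolcsi–Ruzsa 2010, Theorem 1.1 with the intermediate set `S′`** (printed for
`ℤ`; verbatim in any linearly ordered abelian group): for `n ≥ 2` finite non-empty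
`A_0, …, A_{n−1}`, with `A_i′ = {min A_i, max A_i}`, `S = Σ_j A_j`, `S_i = Σ_{j≠i} A_j`,
`S_i′ = S_i + A_i′` and `S′ = ⋃_i S_i′`: `S′ ⊆ S` and `Σ_i |S_i| ≤ (n − 1)|S′| + 1`, i.e.
"`|S| ≥ |S′| ≥ (1/(k−1)) Σ_{i=1}^k |S_i| − 1/(k−1)`".  The family `E` returned IS `j ↦ A_j′`
(first conjunct); it is packaged existentially only to carry the non-emptiness proofs.
[cite: GyarmatiMatolcsiRuzsa2010, Thm 1.1] -/
theorem gmr_superadditivity_biUnion {n : ℕ} (A : ℕ → Finset G) (hA : ∀ j < n, (A j).Nonempty)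
    (hn : 2 ≤ n) :
    ∃ E : ℕ → Finset G,
      (∀ j (hj : j < n), E j = {(A j).min' (hA j hj), (A j).max' (hA j hj)}) ∧
      ((range n).biUnion fun i => (∑ j ∈ (range n).erase i, A j) + E i) ⊆ ∑ j ∈ range n, A j ∧
      ∑ i ∈ range n, #(∑ j ∈ (range n).erase i, A j) ≤
        (n - 1) * #((range n).biUnion fun i => (∑ j ∈ (range n).erase i, A j) + E i) + 1 := by
  refine ⟨fun j => if hj : j < n then {(A j).min' (hA j hj), (A j).max' (hA j hj)} else ∅,
    fun j hj => by simp only [dif_pos hj], ?_, ?_⟩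
  · refine GMR.biUnion_add_subset_sum A _ fun j hj => ?_
    simp only [dif_pos hj]
    intro x hx
    rw [mem_insert, mem_singleton] at hx
    rcases hx with rfl | rfl
    · exact min'_mem _ _
    · exact max'_mem _ _
  · exact GMR.superadditivity_biUnion A _ hA (fun j hj => by simp [dif_pos hj])
      (fun j hj => by simp [dif_pos hj]) hn

end OrderedForms

section TorsionFree

/-- **Gyarmati–Matolcsi–Ruzsa 2010, Theorem 1.3** (torsion-free abelian groups): for `n ≥ 2`
finite non-empty sets `A_0, …, A_{n−1}` in a torsion-free abelian group there are subsets
`A_i′ ⊆ A_i` with at most two elements such that, with `S = Σ_j A_j`, `S_i = Σ_{j≠i} A_j`,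
`S_i′ = S_i + A_i′`, `S′ = ⋃_i S_i′`: `S′ ⊆ S` and `Σ_i |S_i| ≤ (n − 1)|S′| + 1`
("`|S| ≥ |S′| ≥ (1/(k−1)) Σ |S_i| − 1/(k−1)`").  Printed proof: "a standard reduction argument to
the case of integers" (the subgroup generated by the `A_i` is `≅ ℤ^d`, then a map `φ_m : ℤ^d → ℤ`
injective on all the sums involved).  Here (shorter road in Mathlib): the subgroup generated by
the `A_i` is a finitely generated torsion-free `ℤ`-module, hence free
(`Module.basisOfFiniteTypeTorsionFree'`), hence embeds additively in the LINEARLY ORDERED group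
`Lex (Fin d → ℤ)`, where `gmr_superadditivity_biUnion` applies; sizes of all the sumsets involved
are preserved by the injective additive maps. [cite: GyarmatiMatolcsiRuzsa2010, Thm 1.3] -/
theorem gmr_superadditivity_of_isAddTorsionFree {G : Type*} [AddCommGroup G] [DecidableEq G]
    [IsAddTorsionFree G] {n : ℕ} (A : ℕ → Finset G) (hA : ∀ j < n, (A j).Nonempty) (hn : 2 ≤ n) :
    ∃ E : ℕ → Finset G, (∀ j < n, E j ⊆ A j ∧ #(E j) ≤ 2) ∧
      ((range n).biUnion fun i => (∑ j ∈ (range n).erase i, A j) + E i) ⊆ ∑ j ∈ range n, A j ∧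
      ∑ i ∈ range n, #(∑ j ∈ (range n).erase i, A j) ≤
        (n - 1) * #((range n).biUnion fun i => (∑ j ∈ (range n).erase i, A j) + E i) + 1 := by
  classical
  -- the subgroup generated by all the summands: a finitely generated torsion-free `ℤ`-module, free
  set s : Finset G := (range n).biUnion A with hs
  set P : Submodule ℤ G := Submodule.span ℤ (s : Set G) with hP
  have hAP : ∀ j < n, ∀ x ∈ A j, x ∈ P := fun j hj x hx =>
    Submodule.subset_span (by
      rw [hs, coe_biUnion]
      exact Set.mem_biUnion (mem_coe.2 (mem_range.2 hj)) hx)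
  haveI : Module.Finite ℤ P := Module.Finite.iff_fg.mpr ⟨s, rfl⟩
  obtain ⟨d, b⟩ := Module.basisOfFiniteTypeTorsionFree' (R := ℤ) (M := P)
  -- the injective additive maps `P → Lex (Fin d → ℤ)` and `P → G`
  let ψ : P →+ Lex (Fin d → ℤ) :=
    { toFun := fun x => toLex (b.equivFun x)
      map_zero' := by simp
      map_add' := fun x y => by simp [toLex_add] }
  have hψ : Function.Injective ψ := fun x y hxy => b.equivFun.injective (toLex.injective hxy)
  let val : P →+ G :=
    { toFun := Subtype.val
      map_zero' := rfl
      map_add' := fun _ _ => rfl }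
  have hval : Function.Injective val := Subtype.val_injective
  -- the summands lifted to `P`, and pushed into the ordered group
  set B : ℕ → Finset P := fun j => (A j).subtype (· ∈ P) with hB
  have hBA : ∀ j < n, (B j).image val = A j := by
    intro j hj
    ext x
    simp only [hB, mem_image, Finset.mem_subtype]
    constructor
    · rintro ⟨y, hy, rfl⟩; exact hy
    · intro hx; exact ⟨⟨x, hAP j hj x hx⟩, hx, rfl⟩
  have hB_ne : ∀ j < n, (B j).Nonempty := fun j hj => by
    obtain ⟨x, hx⟩ := hA j hj
    exact ⟨⟨x, hAP j hj x hx⟩, by simp only [hB, Finset.mem_subtype]; exact hx⟩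
  -- use the order-derived `DecidableEq` on `Lex (Fin d → ℤ)` throughout (the one in the statement
  -- of `gmr_superadditivity_biUnion`), not `instDecidableEqLex`
  letI : DecidableEq (Lex (Fin d → ℤ)) := LinearOrder.toDecidableEq
  set C : ℕ → Finset (Lex (Fin d → ℤ)) := fun j => (B j).image ψ with hC
  have hC_ne : ∀ j < n, (C j).Nonempty := fun j hj => (hB_ne j hj).image _
  obtain ⟨EL, hELdef, -, hineq⟩ := gmr_superadditivity_biUnion C hC_ne hn
  have hELC : ∀ j < n, EL j ⊆ C j := by
    intro j hj z hz
    rw [hELdef j hj, mem_insert, mem_singleton] at hz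
    rcases hz with rfl | rfl
    · exact min'_mem _ _
    · exact max'_mem _ _
  -- pull the two-element sets back to `P`
  set EP : ℕ → Finset P := fun j => (B j).filter (fun x => ψ x ∈ EL j) with hEP
  have hEPψ : ∀ j < n, (EP j).image ψ = EL j := by
    intro j hj
    ext z
    simp only [hEP, mem_image, mem_filter]
    constructor
    · rintro ⟨x, ⟨-, hxE⟩, rfl⟩; exact hxE
    · intro hz
      have hzC := hELC j hj hz
      simp only [hC, mem_image] at hzC
      obtain ⟨x, hxB, rfl⟩ := hzC
      exact ⟨x, ⟨hxB, hz⟩, rfl⟩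
  have hEPcard : ∀ j < n, #(EP j) ≤ 2 := by
    intro j hj
    rw [← card_image_of_injective (EP j) hψ, hEPψ j hj, hELdef j hj]
    exact card_le_two
  refine ⟨fun j => (EP j).image val, fun j hj => ⟨?_, (card_image_le).trans (hEPcard j hj)⟩, ?_, ?_⟩
  · intro x hx
    rw [mem_image] at hx
    obtain ⟨y, hy, rfl⟩ := hx
    simp only [hEP, mem_filter] at hy
    rw [← hBA j hj]
    exact mem_image_of_mem _ hy.1
  · refine GMR.biUnion_add_subset_sum A _ fun j hj => ?_
    intro x hx
    rw [mem_image] at hx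
    obtain ⟨y, hy, rfl⟩ := hx
    simp only [hEP, mem_filter] at hy
    rw [← hBA j hj]
    exact mem_image_of_mem _ hy.1
  · -- sizes: `G ← P → Lex (Fin d → ℤ)` along the injective additive maps
    have eS : ∀ i ∈ range n,
        #(∑ j ∈ (range n).erase i, A j) = #(∑ j ∈ (range n).erase i, C j) := by
      intro i _
      rw [show ∑ j ∈ (range n).erase i, A j = ∑ j ∈ (range n).erase i, (B j).image val from
        sum_congr rfl fun j hj => (hBA j (mem_range.1 (mem_of_mem_erase hj))).symm,
        GMR.card_sum_image val hval, ← GMR.card_sum_image ψ hψ]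
    have eS' : #((range n).biUnion fun i => (∑ j ∈ (range n).erase i, A j) + (EP i).image val) =
        #((range n).biUnion fun i => (∑ j ∈ (range n).erase i, C j) + EL i) := by
      have h1 : ((range n).biUnion fun i => (∑ j ∈ (range n).erase i, A j) + (EP i).image val) =
          (range n).biUnion fun i =>
            (∑ j ∈ (range n).erase i, (B j).image val) + (EP i).image val :=
        biUnion_congr rfl fun i _ => by
          rw [sum_congr rfl fun j hj => (hBA j (mem_range.1 (mem_of_mem_erase hj))).symm]
      have h2 : ((range n).biUnion fun i => (∑ j ∈ (range n).erase i, C j) + EL i) =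
          (range n).biUnion fun i =>
            (∑ j ∈ (range n).erase i, (B j).image ψ) + (EP i).image ψ :=
        biUnion_congr rfl fun i hi => by rw [hEPψ i (mem_range.1 hi)]
      rw [h1, h2, GMR.card_biUnion_image val hval, GMR.card_biUnion_image ψ hψ]
    rw [sum_congr rfl eS, eS']
    exact hineq

end TorsionFree

end Literature.Combinatorics.Additive
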